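import Literature.Geometry.Riemannian.PerelmanEntropy
import HarnessLib

/-!
# Carrillo–Ni: the sharp logarithmic Sobolev inequality of a complete gradient shrinking soliton
# (named fact) and its consequence `μ(g, 1) ≤ log Θ`

Topic `Geometry/Riemannian`; cite item `wi-16608` (route SmoothPoincare4/EntropyRung, items
`NoncompactShrinkerGap` `stmt-SmoothPoincare4-6808`, `-6810`), over the entropy vocabulary of
`PerelmanEntropy.lean` (`entropyDensity`, `g.wEntropy cov f τ`, `g.IsEntropyCompatible f τ`,
`g.muEntropy cov τ`, `muEntropy_le`) and the metric vocabulary used verbatim by those items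
(`g.ricci`, `g.hessian f`, `g.val`, `g.scalarCurvature`, `g.gradSq f`, `g.riemVolume`,
`g.riemEDist`, `[g.HasLeviCivita]`, `g.leviCivita`).

## Source, as printed

J. A. Carrillo, L. Ni, *Sharp logarithmic Sobolev inequalities on gradient solitons and
applications*, Comm. Anal. Geom. 17 (2009) 721–753 = arXiv:0806.2417 [CarrilloNi2009], read in the
arXiv text:
* **Theorem 1.1** (p. 3): "Assume that `(M, g, f)` is a gradient shrinking soliton, then: i) The
  potential `e^{-f}` is integrable on `M` and it can be normalized as
  `(4πτ)^{-n/2} ∫_M e^{-f} dΓ_τ = 1`. ii) LSI inequality: There exists a geometric invariant `μ_s`,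
  under isometries, which depends only on the value of `f` and `S` at the minimum point of `f` and
  is independent of the parameter `τ`, such that `∫_M {τ[|∇ψ|²_τ + S(·,τ)] + ψ − n} ρ dΓ_τ ≥ −μ_s`,
  for any `τ > 0` and any nonnegative compactly supported smooth function `ρ = e^{-ψ}/(4πτ)^{n/2}`
  with unit integral on `M`. Moreover, the geometric invariant `μ_s` in the above inequality is
  sharp."
* §4 (p. 9): "Thus, the LSI inequality is equivalent to `∫_M [τ(|∇ψ|² + S) + ψ − n] ρ dΓ ≥ −μ_s`,
  for all densities `ρ` with bounded second moment for the shrinking soliton … it is easy to see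
  that `τ(2Δf − |∇f|² + S) + f − n = −μ_s`. Hence `u = e^{-f}/(4πτ)^{n/2}` is the minimizer for
  Perelman's `μ(g, τ)` … This shows that the inequality of Theorem 1.1 is sharp", and
  **Corollary 4.1**: "`μ(g, 1) = −μ_s`."

## Rendering

A gradient shrinking soliton at scale `τ = 1`: a connected manifold with a complete Riemannian
metric (closed `g`-balls compact) and a smooth `f` with `Ric + Hess f = g/2`, the free additive
constant of `f` fixed by `R + |∇f|² = f` — the hypotheses of `NoncompactShrinkerGap` verbatim,
without its dimension, non-compactness and non-flatness clauses. Write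
`Θ := (4π)^{-n/2} ∫_M e^{-f} dV` (`n` the model dimension) and `c := log Θ`. For the normalised
shift `f + c` (unit integral, Thm. 1.1 (i)) the displayed identity of §4 at `τ = 1`, together with
`2Δf − |∇f|² + S = −(S + |∇f|²) + 2(Δf + S) = −f + n` (trace of the soliton equation:
`S + Δf = n/2`), gives `−μ_s = (f + c) − f − … = c`, i.e. `−μ_s = log Θ` for these data. The fact
`CarrilloNi2009_shrinkerLSI` asserts, for such data:
* (i) `e^{-f}` is integrable and the shift `f + log Θ` is compatible,
  `∫ (4π)^{-n/2} e^{-(f + log Θ)} dV = 1` (Thm. 1.1 (i));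
* (ii) **the LSI of §4 at `τ = 1`**: for every smooth `ψ` with `∫ u dV = 1`, `u = (4π)^{-n/2}e^{-ψ}`
  (`g.IsEntropyCompatible ψ 1`), whose density has bounded second moment
  (`∫ d(o,x)² u dV < ∞` for some `o`) and whose `𝒲`-integrand `[(S + |∇ψ|²) + ψ − n] u` is
  integrable (so that the tree's Bochner `𝒲(g, ψ, 1)` IS the printed integral), one has
  `𝒲(g, ψ, 1) ≥ log Θ` (the printed class "densities with bounded second moment", restricted to
  smooth positive densities, which is weaker);
* (iii) **sharpness**: `𝒲(g, f + log Θ, 1) = log Θ` ("`u = e^{-f}/(4πτ)^{n/2}` is the minimizer").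
PROVED from the fact: `muEntropy_le_log` — the tree's `μ(g, 1) = g.muEntropy g.leviCivita 1`
(infimum of the Bochner `𝒲` over ALL smooth compatible functions) satisfies `μ(g,1) ≤ log Θ`
(from (i), (iii) and `muEntropy_le`). The reverse inequality `log Θ ≤ μ(g,1)` for the tree's
class — Carrillo–Ni's Cor. 4.1 / Li–Wang's `Θ = e^{μ(g,1)}` ((2.5) of Trans. AMS 371 (2019)) read
for Perelman's class — is NOT asserted here: the tree's infimum ranges over smooth compatible `ψ`
of unbounded second moment and over `ψ` whose integrand is not integrable (junk value `0`), which
the printed LSI does not cover. Empty `M`: then `Θ = 0`, `log Θ = 0` (Mathlib junk) and every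
clause is vacuous or trivially consistent (no compatible function exists).

## References

* [CarrilloNi2009] J. A. Carrillo, L. Ni, Comm. Anal. Geom. 17 (2009) 721–753 (arXiv:0806.2417):
  Thm. 1.1, §4, Cor. 4.1 (held; read pp. 3 and 9 of the text).
* Y. Li, B. Wang, *Heat kernel on Ricci shrinkers*, Trans. Amer. Math. Soc. 371 (2019), (2.5)
  (context only; not used in a tag).
-/

noncomputable section

open Bundle Set Module Filter MeasureTheory Manifold
open scoped ContDiff Topology ENNReal NNReal

namespace Literature.Geometry.Riemannian

open Lorentzian

/-- **Carrillo–Ni 2009, Thm. 1.1 (i)–(ii) (in the form of §4) with the sharpness clause, at scale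
`τ = 1`, for a complete gradient shrinking Ricci soliton normalised by `R + |∇f|² = f`.** Data: a
connected manifold `M` modelled on `EuclideanSpace ℝ (Fin n)`, a complete Riemannian metric `g`
(closed `g`-balls compact) with its Levi-Civita connection, a smooth `f` with `Ric + Hess f = g/2`
and `R + |∇f|² = f`; `Θ := (4π)^{-n/2} ∫_M e^{-f} dV`. Then: (i) "The potential `e^{-f}` is
integrable on `M` and it can be normalized": `e^{-f} ∈ L¹` and `f + log Θ` is compatible;
(ii) the LSI "`∫_M [τ(|∇ψ|² + S) + ψ − n] ρ dΓ ≥ −μ_s` for all densities `ρ` with bounded second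
moment" at `τ = 1`, where `−μ_s = log Θ` for these data (see the module docstring): for every
smooth compatible `ψ` whose density `u = (4π)^{-n/2} e^{-ψ}` has bounded second moment and whose
`𝒲`-integrand is integrable, `𝒲(g, ψ, 1) ≥ log Θ`; (iii) sharpness, "`u = e^{-f}/(4πτ)^{n/2}` is
the minimizer": `𝒲(g, f + log Θ, 1) = log Θ`. Named fact (D-0014); `μ(g,1) ≤ log Θ` for the
tree's `muEntropy` is the proved `muEntropy_le_log`.
[cite: CarrilloNi2009, Thm. 1.1 (i)–(ii), §4 (bounded second moment form) and Cor. 4.1] -/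
def CarrilloNi2009_shrinkerLSI : Prop :=
  ∀ (n : ℕ) (M : Type) [TopologicalSpace M] [T2Space M] [SecondCountableTopology M]
    [ChartedSpace (EuclideanSpace ℝ (Fin n)) M] [IsManifold (𝓡 n) ∞ M] [ConnectedSpace M]
    [T3Space M] [MeasurableSpace M] [BorelSpace M]
    (g : PseudoRiemannianMetric (𝓡 n) ∞ (EuclideanSpace ℝ (Fin n)) (TangentSpace (𝓡 n) : M → Type _))
    [g.HasLeviCivita] (f : M → ℝ), g.IsRiemannian →
      (∀ (x : M) (r : NNReal), IsCompact {y : M | g.riemEDist x y ≤ r}) →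
      ContMDiff (𝓡 n) 𝓘(ℝ, ℝ) ∞ f →
      (∀ (x : M) (X Y : TangentSpace (𝓡 n) x),
        g.ricci x X Y + g.hessian f x X Y = (1 / 2 : ℝ) * g.val x X Y) →
      (∀ x : M, g.scalarCurvature x + g.gradSq f x = f x) →
        let c : ℝ := Real.log ((4 * Real.pi) ^ (-(n : ℝ) / 2) * ∫ x, Real.exp (-f x) ∂g.riemVolume)
        Integrable (fun x ↦ Real.exp (-f x)) g.riemVolume ∧
        g.IsEntropyCompatible (fun x ↦ f x + c) 1 ∧
        (∀ ψ : M → ℝ, ContMDiff (𝓡 n) 𝓘(ℝ, ℝ) ∞ ψ → g.IsEntropyCompatible ψ 1 →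
          (∃ o : M, Integrable (fun x ↦ (g.riemEDist o x).toReal ^ 2 * entropyDensity n ψ 1 x)
            g.riemVolume) →
          Integrable (fun x ↦ ((g.scalarCurvature x + g.gradSq ψ x) + ψ x - n) *
            entropyDensity n ψ 1 x) g.riemVolume →
          c ≤ g.wEntropy g.leviCivita ψ 1) ∧
        g.wEntropy g.leviCivita (fun x ↦ f x + c) 1 = c

namespace CarrilloNi2009_shrinkerLSI

variable {n : ℕ} {M : Type} [TopologicalSpace M] [T2Space M] [SecondCountableTopology M]
  [ChartedSpace (EuclideanSpace ℝ (Fin n)) M] [IsManifold (𝓡 n) ∞ M] [ConnectedSpace M]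
  [T3Space M] [MeasurableSpace M] [BorelSpace M]
  {g : PseudoRiemannianMetric (𝓡 n) ∞ (EuclideanSpace ℝ (Fin n)) (TangentSpace (𝓡 n) : M → Type _)}
  [g.HasLeviCivita] {f : M → ℝ}

/-- Thm. 1.1 (i): the potential `e^{-f}` of a complete gradient shrinker is integrable.
[cite: CarrilloNi2009, Thm. 1.1 (i)] -/
theorem integrable_exp_neg (h : CarrilloNi2009_shrinkerLSI) (hg : g.IsRiemannian)
    (hc : ∀ (x : M) (r : NNReal), IsCompact {y : M | g.riemEDist x y ≤ r})
    (hf : ContMDiff (𝓡 n) 𝓘(ℝ, ℝ) ∞ f)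
    (hsol : ∀ (x : M) (X Y : TangentSpace (𝓡 n) x),
      g.ricci x X Y + g.hessian f x X Y = (1 / 2 : ℝ) * g.val x X Y)
    (hnorm : ∀ x : M, g.scalarCurvature x + g.gradSq f x = f x) :
    Integrable (fun x ↦ Real.exp (-f x)) g.riemVolume :=
  (h n M g f hg hc hf hsol hnorm).1

/-- **`μ(g, 1) ≤ log Θ`** for the tree's `μ` (infimum of `𝒲` over all smooth compatible
functions): the compatible shift `f + log Θ` of the potential is admissible (Thm. 1.1 (i)) and
`𝒲(g, f + log Θ, 1) = log Θ` (sharpness), so `muEntropy_le` applies. (The reverse inequality for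
the tree's class is not asserted; see the module docstring.) [cite: CarrilloNi2009, Thm. 1.1 (i) and §4 (sharpness)] -/
theorem muEntropy_le_log (h : CarrilloNi2009_shrinkerLSI) (hg : g.IsRiemannian)
    (hc : ∀ (x : M) (r : NNReal), IsCompact {y : M | g.riemEDist x y ≤ r})
    (hf : ContMDiff (𝓡 n) 𝓘(ℝ, ℝ) ∞ f)
    (hsol : ∀ (x : M) (X Y : TangentSpace (𝓡 n) x),
      g.ricci x X Y + g.hessian f x X Y = (1 / 2 : ℝ) * g.val x X Y)
    (hnorm : ∀ x : M, g.scalarCurvature x + g.gradSq f x = f x) :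
    g.muEntropy g.leviCivita 1 ≤
      ((Real.log ((4 * Real.pi) ^ (-(n : ℝ) / 2) * ∫ x, Real.exp (-f x) ∂g.riemVolume) : ℝ) :
        EReal) := by
  obtain ⟨-, hcompat, -, hattain⟩ := h n M g f hg hc hf hsol hnorm
  have hsmooth : ContMDiff (𝓡 n) 𝓘(ℝ, ℝ) ∞ fun x ↦ f x +
      Real.log ((4 * Real.pi) ^ (-(n : ℝ) / 2) * ∫ x, Real.exp (-f x) ∂g.riemVolume) :=
    hf.add contMDiff_const
  have hle := PseudoRiemannianMetric.muEntropy_le (cov := g.leviCivita) hsmooth hcompat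
  rwa [hattain] at hle

end CarrilloNi2009_shrinkerLSI

end Literature.Geometry.Riemannian

end
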